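import Summits.Ventures.PercRepro.RankLevelSetHallForm

/-!
# PercRepro — C-044, UP form: RULE Q (equal split among the members inside a set) gives the Hall condition (night-1, gen 13)

RULE Q: every `S ∈ Y(p,q)` splits one unit equally among the members `Z ⊆ S` of the cell (`memCount M p q S` of them);
a member `Z` receives `ruleQRecv M p q Z = Σ_{S ∈ Y, Z ⊆ S} 1 / memCount S`.  The statement `RuleQUp M p q` (NOT
asserted): every member receives at least `Φ(p,q)`.  THIS FILE: `RuleQUp` implies the UP-Hall condition for every
subfamily `𝒜` of members — the loads are exactly 1, so `Φ·#𝒜 ≤ Σ_{Z ∈ 𝒜} recv(Z) = Σ_{S} #{Z ∈ 𝒜 : Z ⊆ S}/memCount S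
≤ #(UP-neighbourhood of 𝒜)` (`hallUp_of_ruleQ`).  Census (night-1 g13, own exact code, dossier §23.6): at the tight
layer `#E = p + q` Rule Q holds on every loopless matroid with `n ≤ 9` (worst ratio exactly 1, the uniform matroids)
and on the witnesses that kill the degree rule and the proportional rule of (♠′); it is NOT proved.  The definitions
are stated for every `M`, `p`, `q` (Rule Q above the tight layer is open territory).  Axioms: standard.

* `memCount` — the members of the cell inside `S`;
* `ruleQRecv` — what `Z` receives under Rule Q;
* `RuleQUp` — the Rule-Q conjecture for `(M, p, q)` (a `Prop`);
* **`hallUp_of_ruleQ`** — `RuleQUp M p q → ∀ 𝒜 ⊆ cellMembers M p q, phiK p q * #𝒜 ≤ #(upNbhd M p q 𝒜)`.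
-/

namespace PercRepro

open Set Matroid Finset

variable {α : Type} (M : Matroid α) [M.Finite]

/-- `m(S)`: the number of members of the cell `(p, q)` contained in `S`. -/
noncomputable def memCount (p q : ℕ) (S : Set α) : ℕ :=
  {Z : Set α | Z ∈ cellMembers M p q ∧ Z ⊆ S}.ncard

/-- What the member `Z` receives under Rule Q: `Σ_{S ∈ Y, Z ⊆ S} 1 / m(S)`. -/
noncomputable def ruleQRecv (p q : ℕ) (Z : Set α) : ℚ :=
  ∑ S ∈ (cellY_finite M p q).toFinset, Set.indicator {S : Set α | Z ⊆ S} (fun S => 1 / (memCount M p q S : ℚ)) S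

/-- **Rule Q** for the cell `(p, q)` of `M` (a `Prop`; NOT asserted): every member receives at least `Φ(p,q)`. -/
def RuleQUp (p q : ℕ) : Prop :=
  ∀ Z ∈ cellMembers M p q, phiK p q ≤ ruleQRecv M p q Z

/-- The members of the cell are finitely many. -/
theorem cellMembers_finite (p q : ℕ) : (cellMembers M p q).Finite :=
  M.ground_finite.finite_subsets.subset (fun _ hZ => hZ.1)

/-- **Rule Q gives the UP-Hall condition**: if every member receives at least `Φ(p,q)` under the equal split, then
every subfamily `𝒜` of members has at least `Φ(p,q)·#𝒜` UP-neighbours. -/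
theorem hallUp_of_ruleQ (p q : ℕ) (h : RuleQUp M p q) (𝒜 : Set (Set α)) (h𝒜 : 𝒜 ⊆ cellMembers M p q) :
    phiK p q * (𝒜.ncard : ℚ) ≤ ((upNbhd M p q 𝒜).ncard : ℚ) := by
  classical
  have h𝒜fin : 𝒜.Finite := (cellMembers_finite M p q).subset h𝒜
  set 𝒜f : Finset (Set α) := h𝒜fin.toFinset with h𝒜f
  set Yf : Finset (Set α) := (cellY_finite M p q).toFinset with hYf
  have h𝒜card : (𝒜.ncard : ℚ) = (𝒜f.card : ℚ) := by
    rw [h𝒜f, ncard_eq_toFinset_card _ h𝒜fin]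
  -- step 1: Φ·#𝒜 ≤ Σ_{Z ∈ 𝒜} recv(Z)
  have h1 : phiK p q * (𝒜f.card : ℚ) ≤ ∑ Z ∈ 𝒜f, ruleQRecv M p q Z := by
    rw [mul_comm, ← nsmul_eq_mul, ← Finset.sum_const]
    refine Finset.sum_le_sum (fun Z hZ => ?_)
    rw [h𝒜f, h𝒜fin.mem_toFinset] at hZ
    exact h Z (h𝒜 hZ)
  -- step 2: exchange the sums: Σ_Z Σ_{S ∈ Y, Z ⊆ S} 1/m(S) = Σ_{S ∈ Y} #{Z ∈ 𝒜 : Z ⊆ S} · (1/m(S))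
  have h2 : ∑ Z ∈ 𝒜f, ruleQRecv M p q Z =
      ∑ S ∈ Yf, ((𝒜f.filter (fun Z => Z ⊆ S)).card : ℚ) * (1 / (memCount M p q S : ℚ)) := by
    unfold ruleQRecv
    rw [← hYf, Finset.sum_comm]
    refine Finset.sum_congr rfl (fun S _ => ?_)
    simp only [Set.indicator_apply, Set.mem_setOf_eq]
    rw [Finset.sum_ite, Finset.sum_const_zero, add_zero, Finset.sum_const, nsmul_eq_mul]
  -- step 3: each term is at most the indicator of «S contains a member of 𝒜»
  have h3 : ∀ S ∈ Yf, ((𝒜f.filter (fun Z => Z ⊆ S)).card : ℚ) * (1 / (memCount M p q S : ℚ)) ≤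
      (if ∃ Z ∈ 𝒜, Z ⊆ S then (1 : ℚ) else 0) := by
    intro S _
    by_cases hex : ∃ Z ∈ 𝒜, Z ⊆ S
    · rw [if_pos hex]
      have hle : (𝒜f.filter (fun Z => Z ⊆ S)).card ≤ memCount M p q S := by
        unfold memCount
        rw [← ncard_coe_finset]
        refine ncard_le_ncard ?_ ((cellMembers_finite M p q).subset (fun _ hZ => hZ.1))
        intro Z hZ
        rw [Finset.mem_coe, Finset.mem_filter, h𝒜f, h𝒜fin.mem_toFinset] at hZ
        exact ⟨h𝒜 hZ.1, hZ.2⟩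
      have hpos : 0 < memCount M p q S := by
        obtain ⟨Z, hZ, hZS⟩ := hex
        have : (𝒜f.filter (fun Z => Z ⊆ S)).card ≠ 0 := by
          rw [Finset.card_ne_zero]
          exact ⟨Z, Finset.mem_filter.2 ⟨by rw [h𝒜f, h𝒜fin.mem_toFinset]; exact hZ, hZS⟩⟩
        omega
      have hposq : (0 : ℚ) < (memCount M p q S : ℚ) := by exact_mod_cast hpos
      rw [mul_one_div, div_le_one hposq]
      exact_mod_cast hle
    · rw [if_neg hex]
      have hzero : (𝒜f.filter (fun Z => Z ⊆ S)).card = 0 := by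
        rw [Finset.card_eq_zero, Finset.filter_eq_empty_iff]
        intro Z hZ hZS
        rw [h𝒜f, h𝒜fin.mem_toFinset] at hZ
        exact hex ⟨Z, hZ, hZS⟩
      rw [hzero]
      simp
  -- step 4: the indicators sum to the size of the UP-neighbourhood
  have h4 : ∑ S ∈ Yf, (if ∃ Z ∈ 𝒜, Z ⊆ S then (1 : ℚ) else 0) = ((upNbhd M p q 𝒜).ncard : ℚ) := by
    rw [Finset.sum_ite, Finset.sum_const_zero, add_zero, Finset.sum_const, nsmul_eq_mul, mul_one]
    have hU : upNbhd M p q 𝒜 = ((Yf.filter (fun S => ∃ Z ∈ 𝒜, Z ⊆ S) : Finset (Set α)) : Set (Set α)) := by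
      ext S
      rw [Finset.coe_filter, hYf, Set.mem_setOf_eq, (cellY_finite M p q).mem_toFinset]
      constructor
      · intro hS
        exact ⟨⟨hS.1, hS.2.1, hS.2.2.1⟩, hS.2.2.2⟩
      · intro hS
        exact ⟨hS.1.1, hS.1.2.1, hS.1.2.2, hS.2⟩
    rw [hU, ncard_coe_finset]
  calc phiK p q * (𝒜.ncard : ℚ) = phiK p q * (𝒜f.card : ℚ) := by rw [h𝒜card]
    _ ≤ ∑ Z ∈ 𝒜f, ruleQRecv M p q Z := h1
    _ = ∑ S ∈ Yf, ((𝒜f.filter (fun Z => Z ⊆ S)).card : ℚ) * (1 / (memCount M p q S : ℚ)) := h2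
    _ ≤ ∑ S ∈ Yf, (if ∃ Z ∈ 𝒜, Z ⊆ S then (1 : ℚ) else 0) := Finset.sum_le_sum h3
    _ = ((upNbhd M p q 𝒜).ncard : ℚ) := h4

end PercRepro
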